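import Summits.Schanuel.Schanuel.Theses.DiophantineDichotomy
import Summits.Schanuel.Schanuel.Theorems.EPiSimultaneousType.Negative.CoordinatewiseLinear

/-!
# No COMPLEX number has a polynomial measure with degree exponent `a < 1` (two-dimensional box)
(negative lemma for crux `EPiSimultaneousType`, stmt-Schanuel-6118, route DiophantineDichotomy;
cdisprove cycle 2 — companion of `Negative/DirichletPoly.lean`, which treats real points)

* `EPiSimultaneousType.exists_intPoly_small_at_complex` — Dirichlet's box for a complex point:
  `d ≥ 1`, `H ≥ 6` ⇒ `P ∈ ℤ[X] ∖ 0`, `deg P ≤ d`, height `≤ H`,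
  `|P(ξ)| ≤ 8(d+1)max(1,|ξ|)^d / √(H^{d−1})` (pigeonhole on the `(H+1)^{d+1}` values `Σ cᵢ ξⁱ`,
  bucketed by real and imaginary parts).
* `complex_polyMeasure_false_of_exponent_lt_one` — hence `PolyMeasure ξ a` (the template of
  `Lines/compositum-defect-split.lean`, verbatim: `ξ : ℂ`, `0 < C`) is EMPTY for every `ξ ∈ ℂ`
  and every `a < 1`: the hypothesis of that line's `stub_pointMeasure_of_polyMeasure` is never
  met below `a = 1`, for any base point whatsoever.

Everything is proved (definition-free); axioms `propext`, `Classical.choice`, `Quot.sound`.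
-/

set_option linter.dupNamespace false

noncomputable section

namespace Summit.Schanuel.Schanuel.Theorems

open Polynomial

namespace EPiSimultaneousType

/-- **Dirichlet's box principle for integer polynomials at a complex point**: for `d ≥ 1`, `H ≥ 6`
there is `P ∈ ℤ[X] ∖ {0}`, `deg P ≤ d`, `|coeff| ≤ H`, with
`|P(ξ)| ≤ 8(d+1)max(1,|ξ|)^d / √(H^{d−1})`. [folklore] -/
theorem exists_intPoly_small_at_complex (ξ : ℂ) {d H : ℕ} (hd : 1 ≤ d) (hH : 6 ≤ H) :
    ∃ P : Polynomial ℤ, P ≠ 0 ∧ P.natDegree ≤ d ∧ (∀ k, |P.coeff k| ≤ (H : ℤ)) ∧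
      ‖Polynomial.aeval ξ P‖ ≤ 8 * (d + 1) * max 1 ‖ξ‖ ^ d / Real.sqrt ((H : ℝ) ^ (d - 1)) := by
  set R : ℝ := max 1 ‖ξ‖ with hR
  have hR1 : 1 ≤ R := le_max_left _ _
  have hξR : ‖ξ‖ ≤ R := le_max_right _ _
  let val : (Fin (d + 1) → Fin (H + 1)) → ℂ := fun c => ∑ i : Fin (d + 1), ((c i : ℕ) : ℂ) * ξ ^ (i : ℕ)
  set B : ℝ := (d + 1) * H * R ^ d with hB
  have hHpos : (0 : ℝ) < H := by exact_mod_cast (by omega : 0 < H)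
  have hBpos : 0 < B := by positivity
  have hval : ∀ c, ‖val c‖ ≤ B := by
    intro c
    calc ‖val c‖ ≤ ∑ i : Fin (d + 1), ‖((c i : ℕ) : ℂ) * ξ ^ (i : ℕ)‖ := norm_sum_le _ _
      _ ≤ ∑ _i : Fin (d + 1), (H : ℝ) * R ^ d := by
          apply Finset.sum_le_sum
          intro i _
          rw [norm_mul, norm_pow, Complex.norm_natCast]
          have hc : ((c i : ℕ) : ℝ) ≤ H := by
            have := (c i).isLt
            exact_mod_cast (by omega : (c i : ℕ) ≤ H)
          apply mul_le_mul hc _ (by positivity) hHpos.le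
          calc ‖ξ‖ ^ (i : ℕ) ≤ R ^ (i : ℕ) := pow_le_pow_left₀ (norm_nonneg ξ) hξR _
            _ ≤ R ^ d := pow_le_pow_right₀ hR1 (by omega)
      _ = B := by simp [hB]; ring
  -- pigeonhole: N = (H+1)^(d+1) vectors, buckets (⌊re/η⌋, ⌊im/η⌋) ∈ [-K, K]², η = 4B/√N
  set N : ℕ := (H + 1) ^ (d + 1) with hN
  have hN49 : 49 ≤ N := by
    have h7 : 7 ≤ H + 1 := by omega
    calc 49 = 7 ^ 2 := by norm_num
      _ ≤ (H + 1) ^ 2 := Nat.pow_le_pow_left h7 2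
      _ ≤ (H + 1) ^ (d + 1) := Nat.pow_le_pow_right (by omega) (by omega)
  have hNpos : (0 : ℝ) < N := by exact_mod_cast (by omega : 0 < N)
  set t : ℝ := Real.sqrt N with ht
  have ht7 : 7 ≤ t := by
    rw [ht, show (7 : ℝ) = Real.sqrt 49 by rw [show (49 : ℝ) = 7 ^ 2 by norm_num, Real.sqrt_sq (by norm_num)]]
    exact Real.sqrt_le_sqrt (by exact_mod_cast hN49)
  have htpos : 0 < t := by linarith
  have htsq : t ^ 2 = N := by rw [ht, Real.sq_sqrt hNpos.le]
  set η : ℝ := 4 * B / t with hη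
  have hηpos : 0 < η := by positivity
  set K : ℤ := ⌈B / η⌉ with hK
  have hBη : B / η = t / 4 := by
    rw [hη]; field_simp
  have hKle : (K : ℝ) < t / 4 + 1 := by
    have h1 : (K : ℝ) < B / η + 1 := by rw [hK]; exact Int.ceil_lt_add_one _
    rw [hBη] at h1
    exact h1
  have hK0 : 0 ≤ K := by rw [hK]; exact Int.ceil_nonneg (by positivity)
  have hbucket : ∀ x : ℝ, |x| ≤ B → ⌊x / η⌋ ∈ Finset.Icc (-K) K := by
    intro x hx
    rw [abs_le] at hx
    rw [Finset.mem_Icc]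
    constructor
    · have h1 : -(B / η) ≤ x / η := by
        rw [← neg_div]; exact div_le_div_of_nonneg_right hx.1 hηpos.le
      rw [Int.le_floor]
      push_cast
      have : (B / η) ≤ (K : ℝ) := Int.le_ceil _
      linarith
    · rw [← Int.lt_add_one_iff, Int.floor_lt]
      push_cast
      have : x / η ≤ B / η := div_le_div_of_nonneg_right hx.2 hηpos.le
      have : (B / η) ≤ (K : ℝ) := Int.le_ceil _
      linarith
  have hmaps : ∀ c, (⌊(val c).re / η⌋, ⌊(val c).im / η⌋) ∈ Finset.Icc (-K) K ×ˢ Finset.Icc (-K) K := by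
    intro c
    rw [Finset.mem_product]
    exact ⟨hbucket _ ((Complex.abs_re_le_norm _).trans (hval c)),
      hbucket _ ((Complex.abs_im_le_norm _).trans (hval c))⟩
  have hcard : (Finset.Icc (-K) K ×ˢ Finset.Icc (-K) K).card <
      (Finset.univ : Finset (Fin (d + 1) → Fin (H + 1))).card := by
    rw [Finset.card_product, Finset.card_univ, Fintype.card_fun, Fintype.card_fin, Fintype.card_fin,
      Int.card_Icc]
    have h2K : ((K + 1 - -K).toNat : ℤ) = 2 * K + 1 := by
      rw [Int.toNat_of_nonneg (by omega)]; ring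
    -- (2K+1)^2 < N via 2K+1 < t/2 + 3 ≤ t
    have hreal : (2 * (K : ℝ) + 1) ^ 2 < N := by
      have h1 : 2 * (K : ℝ) + 1 < t := by linarith
      have h0 : 0 ≤ 2 * (K : ℝ) + 1 := by
        have : (0 : ℝ) ≤ K := by exact_mod_cast hK0
        linarith
      rw [← htsq]
      exact pow_lt_pow_left₀ h1 h0 (by norm_num)
    have hint : (2 * K + 1) ^ 2 < (N : ℤ) := by exact_mod_cast hreal
    have h3 : ((K + 1 - -K).toNat : ℤ) * ((K + 1 - -K).toNat : ℤ) < (N : ℤ) := by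
      rw [h2K, ← sq]; exact hint
    rw [hN] at h3
    exact_mod_cast h3
  obtain ⟨c, -, c', -, hne, hcc⟩ :=
    Finset.exists_ne_map_eq_of_card_lt_of_maps_to hcard
      (f := fun c => (⌊(val c).re / η⌋, ⌊(val c).im / η⌋)) (fun c _ => hmaps c)
  simp only [Prod.mk.injEq] at hcc
  -- the difference is small: both parts within η
  have hclose : ‖val c - val c'‖ < 2 * η := by
    have hre := Int.abs_sub_lt_one_of_floor_eq_floor hcc.1
    have him := Int.abs_sub_lt_one_of_floor_eq_floor hcc.2
    rw [← sub_div, abs_div, abs_of_pos hηpos, div_lt_one hηpos] at hre him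
    calc ‖val c - val c'‖ ≤ |(val c - val c').re| + |(val c - val c').im| :=
          Complex.norm_le_abs_re_add_abs_im _
      _ = |(val c).re - (val c').re| + |(val c).im - (val c').im| := by
          rw [Complex.sub_re, Complex.sub_im]
      _ < η + η := add_lt_add hre him
      _ = 2 * η := by ring
  let e : ℕ → ℤ := fun i => if h : i < d + 1 then ((c ⟨i, h⟩ : ℕ) : ℤ) - ((c' ⟨i, h⟩ : ℕ) : ℤ) else 0
  set P : Polynomial ℤ := ∑ i ∈ Finset.range (d + 1), Polynomial.C (e i) * Polynomial.X ^ i with hP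
  have hcoeff : ∀ k, P.coeff k = if k < d + 1 then e k else 0 := by
    intro k
    simp only [hP, Polynomial.finsetSum_coeff, Polynomial.coeff_C_mul_X_pow]
    rw [Finset.sum_ite_eq]
    simp only [Finset.mem_range]
  refine ⟨P, ?_, ?_, ?_, ?_⟩
  · intro h0
    apply hne
    funext i
    have hk := hcoeff i
    rw [h0, Polynomial.coeff_zero, if_pos i.isLt] at hk
    have : e i = 0 := hk.symm
    simp only [e, dif_pos i.isLt, Fin.eta] at this
    exact Fin.ext (by omega)
  · rw [Polynomial.natDegree_le_iff_coeff_eq_zero]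
    intro m hm
    rw [hcoeff, if_neg]
    omega
  · intro k
    rw [hcoeff]
    split_ifs with hk
    · simp only [e, dif_pos hk]
      have h1 := (c ⟨k, hk⟩).isLt
      have h2 := (c' ⟨k, hk⟩).isLt
      rw [abs_le]
      constructor <;> omega
    · simp
  · have heval : Polynomial.aeval ξ P = val c - val c' := by
      simp only [hP, map_sum, map_mul, Polynomial.aeval_C, Polynomial.aeval_X_pow]
      simp only [algebraMap_int_eq, eq_intCast, val]
      rw [← Finset.sum_sub_distrib, Finset.sum_range (fun i => ((e i : ℤ) : ℂ) * ξ ^ i)]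
      apply Finset.sum_congr rfl
      intro i _
      simp only [e, dif_pos i.isLt, Fin.eta, Int.cast_sub, Int.cast_natCast]
      ring
    rw [heval]
    refine hclose.le.trans ?_
    -- 2η = 8B/t ≤ 8(d+1)R^d/√(H^(d-1)):  B/t = (d+1) H R^d / √((H+1)^(d+1)) ≤ (d+1) R^d / √(H^(d-1))
    have hsqrtH : Real.sqrt ((H : ℝ) ^ (d + 1)) = H * Real.sqrt ((H : ℝ) ^ (d - 1)) := by
      rw [show d + 1 = 2 + (d - 1) by omega, pow_add, Real.sqrt_mul (by positivity), Real.sqrt_sq hHpos.le]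
    have hmono : Real.sqrt ((H : ℝ) ^ (d + 1)) ≤ t := by
      rw [ht, hN]
      push_cast
      exact Real.sqrt_le_sqrt (pow_le_pow_left₀ hHpos.le (by linarith) _)
    have hspos : 0 < Real.sqrt ((H : ℝ) ^ (d - 1)) := Real.sqrt_pos.mpr (pow_pos hHpos _)
    have hHs : (H : ℝ) * Real.sqrt ((H : ℝ) ^ (d - 1)) ≤ t := hsqrtH ▸ hmono
    rw [hη, hB]
    rw [show 2 * (4 * ((d + 1 : ℝ) * H * R ^ d) / t) = (8 * (d + 1) * R ^ d) * (H / t) by ring]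
    rw [show 8 * ((d : ℝ) + 1) * max 1 ‖ξ‖ ^ d / Real.sqrt ((H : ℝ) ^ (d - 1)) =
      (8 * (d + 1) * R ^ d) * (1 / Real.sqrt ((H : ℝ) ^ (d - 1))) by rw [hR]; ring]
    apply mul_le_mul_of_nonneg_left _ (by positivity)
    rw [div_le_div_iff₀ htpos hspos, one_mul]
    exact hHs

end EPiSimultaneousType

open EPiSimultaneousType

/-- **`PolyMeasure ξ a` is empty for every `ξ ∈ ℂ` and every `a < 1`** — in the exact shape of
`Lines/compositum-defect-split.lean` (`0 < C`; in fact no `b, C` of any sign work): choose `d`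
with `d/2 ≥ |C|d^{max(a,0)} + 1`, then `H ≥ 6` with `log H > 2(|C|d^b + log(8(d+1)max(1,|ξ|)^d))`;
the box polynomial beats the bound. [folklore] -/
theorem complex_polyMeasure_false_of_exponent_lt_one (ξ : ℂ) {a : ℝ} (ha : a < 1) :
    ¬ ∃ b C : ℝ, 0 < C ∧ ∀ (d H : ℕ) (P : Polynomial ℤ), 1 ≤ d → P ≠ 0 → P.natDegree ≤ d →
      (∀ k, |P.coeff k| ≤ (H : ℤ)) →
        Real.exp (-(C * ((d : ℝ) ^ a * Real.log H + (d : ℝ) ^ b))) ≤ ‖Polynomial.aeval ξ P‖ := by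
  rintro ⟨b, C, -, hM⟩
  set s : ℝ := max a 0 with hsdef
  have hs0 : 0 ≤ s := le_max_right _ _
  have hs1 : s < 1 := max_lt ha one_pos
  have has : a ≤ s := le_max_left _ _
  obtain ⟨d, hd1, hd⟩ := exists_nat_linear_beats_rpow (C' := |C|) (by norm_num : (0 : ℝ) < 1 / 2) hs0 hs1
  set R : ℝ := max 1 ‖ξ‖ with hR
  set Q : ℝ := 8 * (d + 1) * R ^ d with hQ
  have hQpos : 0 < Q := by positivity
  set M : ℝ := |C| * (d : ℝ) ^ b + Real.log Q with hMdef
  set H : ℕ := ⌈Real.exp (2 * M)⌉₊ + 6 with hHdef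
  have hH6 : 6 ≤ H := Nat.le_add_left 6 _
  have hHpos : (0 : ℝ) < H := by exact_mod_cast (by omega : 0 < H)
  have hlogH : 2 * M < Real.log H := by
    rw [← Real.exp_lt_exp, Real.exp_log hHpos]
    have h1 : Real.exp (2 * M) ≤ ⌈Real.exp (2 * M)⌉₊ := Nat.le_ceil _
    have h2 : ((⌈Real.exp (2 * M)⌉₊ + 6 : ℕ) : ℝ) = H := by rw [hHdef]
    push_cast at h2
    linarith
  have hlog0 : 0 < Real.log H := Real.log_pos (by exact_mod_cast (by omega : 1 < H))
  obtain ⟨P, hP0, hdeg, hcoeff, hsmall⟩ := exists_intPoly_small_at_complex ξ hd1 hH6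
  have hmeas := hM d H P hd1 hP0 hdeg hcoeff
  have hd1' : (1 : ℝ) ≤ d := by exact_mod_cast hd1
  have hcast : ((d - 1 : ℕ) : ℝ) = (d : ℝ) - 1 := by push_cast [Nat.cast_sub hd1]; ring
  have hlt : Q / Real.sqrt ((H : ℝ) ^ (d - 1)) <
      Real.exp (-(C * ((d : ℝ) ^ a * Real.log H + (d : ℝ) ^ b))) := by
    have hL : Q / Real.sqrt ((H : ℝ) ^ (d - 1)) =
        Real.exp (Real.log Q - ((d : ℝ) - 1) * Real.log H * (1 / 2)) := by
      rw [Real.exp_sub, Real.exp_log hQpos, Real.sqrt_eq_rpow, Real.rpow_def_of_pos (pow_pos hHpos _),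
        Real.log_pow, hcast]
    rw [hL, Real.exp_lt_exp]
    have hda : (d : ℝ) ^ a ≤ (d : ℝ) ^ s := Real.rpow_le_rpow_of_exponent_le hd1' has
    have hdb : 0 < (d : ℝ) ^ b := by positivity
    have h1 : C * ((d : ℝ) ^ a * Real.log H + (d : ℝ) ^ b) ≤
        |C| * (d : ℝ) ^ s * Real.log H + |C| * (d : ℝ) ^ b := by
      have h0 : 0 ≤ (d : ℝ) ^ a * Real.log H + (d : ℝ) ^ b := by positivity
      calc C * ((d : ℝ) ^ a * Real.log H + (d : ℝ) ^ b)
          ≤ |C| * ((d : ℝ) ^ a * Real.log H + (d : ℝ) ^ b) := by gcongr; exact le_abs_self C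
        _ ≤ |C| * ((d : ℝ) ^ s * Real.log H + (d : ℝ) ^ b) := by gcongr
        _ = _ := by ring
    -- (d-1)/2 - |C| d^s ≥ 1/2 from hd : |C| d^s + 1 ≤ d/2
    have h3 := mul_nonneg (by linarith : (0 : ℝ) ≤ (d - 1) / 2 - |C| * (d : ℝ) ^ s - 1 / 2) hlog0.le
    rw [hMdef] at hlogH
    nlinarith
  have : Q / Real.sqrt ((H : ℝ) ^ (d - 1)) < Q / Real.sqrt ((H : ℝ) ^ (d - 1)) := by
    calc Q / Real.sqrt ((H : ℝ) ^ (d - 1)) < _ := hlt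
      _ ≤ ‖Polynomial.aeval ξ P‖ := hmeas
      _ ≤ 8 * (d + 1) * max 1 ‖ξ‖ ^ d / Real.sqrt ((H : ℝ) ^ (d - 1)) := hsmall
      _ = Q / Real.sqrt ((H : ℝ) ^ (d - 1)) := by rw [hQ, hR]
  exact lt_irrefl _ this

end Summit.Schanuel.Schanuel.Theorems

end
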